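import Mathlib
import Summits.ResolutionOfSingularities.ResolutionOfSingularities.Theorems.RadicialJungCleanModelsLens5TFramePDegreeA
import HarnessLib

/-!
# Route `RadicialJung`, crux `CleanModels` (stmt-15917): T⁗ port part 12/13 — `Lens5_PDegreeCount.lean` §C the count `[K:K^p] = p^{r+3}`, §D THEOREM T⁗″ `cleanLU3DefectPRankTwoPBasis_of_pMon`, §E `p`-monomial bases (source :383–635; the def is in the currency)

PORT (line lead `res-B-lead-1` g8, for Sketch rev 32) of res-B-lens-5's crux workfiles `Cruxes/DescentPerfectToAll/Lens5_TFrame.lean` rev 4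
(crux ae884a356928; author res-B-lens-5 g15; `lean check` rc 0 · 0 sorries · 0 warnings; crit-1 TRIAGE-146/150 PASS) and
`Cruxes/DescentPerfectToAll/Lens5_PDegreeCount.lean` rev 3 (crux 100289d6413b; TRIAGE-151 PASS): THEOREMS T⁗ / T⁗′ / T⁗″ / T⁗‴ — the slice
{`[Γ:pΓ] = p²`, `k` of FINITE `p`-rank `r`, `[κ_v : κ_v^p] = p^r`} of the research stub `stub_cleanLU3DefectNonDiscrete` (valuations of MINIMAL
Frobenius defect `d(K|K^p, v) = p`, ANY such ground field: no perfectness, no separability of `K/k` or `κ_v/k`), modulo F-02 `CossartPiltant2019` and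
F-32 (`hEmb`) only.  The port is split into def-free modules `…Lens5TFrame{RG,IR,Graded,Port2,Port4Core,Layer,Layer2,Port4,Composition,PMon,PDegreeA,PDegreeB,PDegreeC}`
over ONE currency module `…Lens5TFrameCurrency` (the authors' `def`s, verbatim); declarations VERBATIM, namespace
`Summit.ResolutionOfSingularities.ResolutionOfSingularities.Theorems.RadicialJungCleanModels.Lens5TFrame` (the authors' §A copy of
`Lens5_PDegreeSep` and the constant-frame corollaries `cleanLU3DefectPRankTwoSepFin_of_frame` / `…SepFin_of_cossartPiltant2019'` are not ported).
OURS · counted 0 · nothing here proves resolution in characteristic `p`.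


-/

set_option linter.dupNamespace false -- mandated namespace of this single-conjunct summit

noncomputable section

section

open IsLocalRing IntermediateField Module MvPolynomial
open Literature.AlgebraicGeometry.Resolution
open Summit.ResolutionOfSingularities.ResolutionOfSingularities.Theorems.RadicialJung.CleanModels
open Summit.ResolutionOfSingularities.ResolutionOfSingularities.Theorems.RadicialJung.CleanModels.Lens5
open Summit.ResolutionOfSingularities.ResolutionOfSingularities.Theorems.RadicialJung.CleanModels.Lens5.PRankTwoCurrency
open Summit.ResolutionOfSingularities.ResolutionOfSingularities.Theorems.RadicialJung.CleanModels.Lens5.PRankTwoAssembly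
open Summit.ResolutionOfSingularities.ResolutionOfSingularities.Theorems.RadicialJungCleanModels.Lens5RegularityCriterion
open Summit.ResolutionOfSingularities.ResolutionOfSingularities.Theorems.RadicialJungCleanModels.Lens5ChartSurjection

namespace Summit.ResolutionOfSingularities.ResolutionOfSingularities.Theorems.RadicialJungCleanModels.Lens5TFrame

/-! ## §C `[K : K^p] = p^{r+3}` for the function field of a three-dimensional variety over a ground field with a `p`-basis of `r` elements -/

/-- **The count `[K : K^p] = p^{r+3}`**: `K = Frac A`, `A` a finitely generated algebra of Krull dimension `3` over a field `k` with a finite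
`p`-basis `β` of `r` elements.  A transcendence basis `s` (three elements) gives `k(s) ⊆ K` finite, `[K : K^p] = [k(s) : k(s)^p]` (§A) and
`[k(s) : k(s)^p] = p^{r+3}` (§B).  No separability hypothesis on `K/k` (Mac Lane's function fields without separating transcendence bases
included). [cite: Matsumura1987, §26 Thm. 26.10] -/
theorem finrank_frobenius_eq_pow_of_pBasis {k K : Type} [Field k] [Field K] [Algebra k K] (p : ℕ) [Fact p.Prime] [CharP k p] [CharP K p]
    (A : Subalgebra k K) (hAfg : A.FG) (hfrac : IsFractionRing A K) (hdim : ringKrullDim A = 3)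
    {r : ℕ} (β : Fin r → k) (hβspan : IsPSpanningFamily p (pMonomial p β))
    (hβfree : ∀ i, β i ∉ Subfield.closure (Set.range (fun x : k => x ^ p) ∪ β '' ({i}ᶜ : Set (Fin r)))) :
    finrank (frobenius K p).fieldRange K = p ^ (r + 3) := by
  classical
  -- ### transcendence degree `3` and a transcendence basis of three elements
  haveI : Algebra.FiniteType k A := A.fg_iff_finiteType.mp hAfg
  haveI : Algebra.EssFiniteType A K := Algebra.EssFiniteType.of_isLocalization K (nonZeroDivisors A)
  haveI : Algebra.EssFiniteType k K := Algebra.EssFiniteType.comp k A K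
  obtain ⟨d, hd, htr⟩ := Literature.RingTheory.KrullDimension.exists_ringKrullDim_eq_and_trdeg_eq k A
  have hd3 : d = 3 := by
    rw [hd] at hdim
    exact_mod_cast hdim
  haveI : FaithfulSMul k A := (faithfulSMul_iff_algebraMap_injective k A).mpr (algebraMap k A).injective
  haveI : FaithfulSMul A K := (faithfulSMul_iff_algebraMap_injective A K).mpr (IsFractionRing.injective A K)
  haveI : Algebra.IsAlgebraic A K := IsLocalization.isAlgebraic K (nonZeroDivisors A)
  have htrK : Algebra.trdeg k K = (3 : ℕ) := by
    rw [← trdeg_add_eq k A (A := K), trdeg_eq_zero (R := A) (A := K), add_zero, htr, hd3]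
  obtain ⟨t, ht⟩ := exists_isTranscendenceBasis k K
  have hmk : Cardinal.mk t = (3 : ℕ) := by rw [ht.cardinalMk_eq_trdeg, htrK]
  have htfin : t.Finite := by
    rw [← Cardinal.lt_aleph0_iff_set_finite, hmk]
    exact Cardinal.natCast_lt_aleph0
  obtain ⟨s, hcoe⟩ : ∃ s : Finset K, (s : Set K) = t := ⟨htfin.toFinset, htfin.coe_toFinset⟩
  subst hcoe
  have hcard : s.card = 3 := by
    have h : Cardinal.mk s = (3 : ℕ) := hmk
    rw [Cardinal.mk_coe_finset] at h
    exact_mod_cast h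
  have hs : AlgebraicIndependent k ((↑) : s → K) := ht.1
  -- ### the purely transcendental subfield `F := k(s)` and `K/F` finite
  set F : IntermediateField k K := adjoin k (s : Set K) with hFdef
  haveI : CharP F p := (algebraMap F K).charP (algebraMap F K).injective p
  have halg : Algebra.IsAlgebraic F K := by
    have h := ht.isAlgebraic_field
    rwa [Subtype.range_coe] at h
  haveI := halg
  haveI : Algebra.EssFiniteType F K := Algebra.EssFiniteType.of_comp k F K
  haveI : Module.Finite F K := Algebra.finite_of_essFiniteType_of_isAlgebraic
  -- ### `s` read inside `F`
  let ι : s → F := fun x => ⟨x.1, subset_adjoin k (s : Set K) (Finset.mem_coe.mpr x.2)⟩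
  have hι : Function.Injective ι := fun a b h => Subtype.ext (congrArg (fun z : F => (z : K)) h)
  set sF : Finset F := Finset.univ.image ι with hsFdef
  have hsFcard : sF.card = 3 := by
    rw [hsFdef, Finset.card_image_of_injective _ hι, Finset.card_univ, ← hcard]
    exact Fintype.card_coe s
  have hval : ∀ y : sF, ((y : F) : K) ∈ s := by
    intro y
    obtain ⟨x, _, hx⟩ := Finset.mem_image.mp y.2
    rw [← hx]
    exact x.2
  -- algebraic independence of `sF` over `k` inside `F`
  have hsF : AlgebraicIndependent k ((↑) : sF → F) := by
    have hinj : Function.Injective ((F.val : F →ₐ[k] K) ∘ ((↑) : sF → F)) := by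
      intro a b h
      exact Subtype.ext (Subtype.ext h)
    have hrange : Set.range ((F.val : F →ₐ[k] K) ∘ ((↑) : sF → F)) ⊆ (s : Set K) := by
      rintro z ⟨y, rfl⟩
      exact hval y
    exact AlgebraicIndependent.of_comp F.val ((algebraicIndependent_subtype_range hinj).mp (hs.mono hrange))
  -- `F = k(sF)` internally
  have himage : ((↑) : F → K) '' (sF : Set F) = (s : Set K) := by
    ext z
    constructor
    · rintro ⟨y, hy, rfl⟩
      exact hval ⟨y, hy⟩
    · intro hz
      exact ⟨ι ⟨z, hz⟩, Finset.mem_coe.mpr (Finset.mem_image.mpr ⟨⟨z, hz⟩, Finset.mem_univ _, rfl⟩), rfl⟩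
  have htopF : adjoin k (sF : Set F) = ⊤ := by
    apply IntermediateField.lift_injective
    rw [lift_adjoin, lift_top, himage]
  -- ### count
  rw [finrank_frobenius_eq_of_finite p (F := F) (K := K),
    finrank_frobenius_purelyTranscendental p sF hsF htopF β hβspan hβfree, hsFcard]


/-! ## §D THEOREM T⁗″: the slice over a ground field with a finite `p`-basis -/


/-- **T⁗″ ⊂ T⁗′** (kernel): over a ground field with a `p`-basis of `r` elements the count `[K : K^p] = p^{r+3}` HOLDS (§C), so T⁗′ applies
with the `p`-spanning family `pMonomial p β`. [folklore] -/
theorem cleanLU3DefectPRankTwoPBasis_of_pMon (p : ℕ) [Fact p.Prime] (hPMon : CleanLU3DefectPRankTwoPMonAt p) :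
    CleanLU3DefectPRankTwoPBasisAt p := by
  intro k _ _ K _ _ O A hAO hAfg hFrac hdimA hreg hdim3 hzd g₀ hg₀ hdefect htd hnd hP2 r β hβspan hβfree w hwO hPI
  classical
  haveI : CharP K p := charP_of_injective_algebraMap (algebraMap k K).injective p
  have hdimA3 : ringKrullDim A = 3 := ringKrullDim_eq_three_of_locAtCentre O A hAO hdimA hdim3
  have hcount := finrank_frobenius_eq_pow_of_pBasis p A hAfg hFrac hdimA3 β hβspan hβfree
  have hcl : Subfield.closure (Set.range (fun x : K => x ^ p)) = (frobenius K p).fieldRange := by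
    apply le_antisymm
    · refine Subfield.closure_le.mpr ?_
      rintro z ⟨u, rfl⟩
      exact RingHom.mem_fieldRange.mpr ⟨u, frobenius_def ..⟩
    · intro z hz
      obtain ⟨u, rfl⟩ := RingHom.mem_fieldRange.mp hz
      exact Subfield.subset_closure ⟨u, (frobenius_def ..).symm⟩
  have hK : Module.finrank (Subfield.closure (Set.range (fun x : K => x ^ p))) K = p ^ (r + 3) := by
    rw [hcl]; exact hcount
  exact hPMon k K O A hAO hAfg hFrac hdimA hreg hdim3 hzd g₀ hg₀ hdefect htd hnd hP2 (Fin r → Fin p) (pMonomial p β) hβspan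
    r w hwO hPI hK

/-! ## §E `p`-monomials of a finite family: they span `E^p[β]`, and for a `p`-independent `β` they are linearly independent over `E^p` -/

section MonomialBasis

variable {E : Type} [Field E] (p : ℕ) [Fact p.Prime] [CharP E p]

omit [Fact p.Prime] [CharP E p] in
/-- `pMonomial` transported along a ring hom. [folklore] -/
theorem map_pMonomial {K L : Type} [Field K] [Field L] (f : K →+* L) {r : ℕ} (w : Fin r → K) (e : Fin r → Fin p) :
    f (pMonomial p w e) = pMonomial p (fun i => f (w i)) e := by
  simp [pMonomial, map_prod, map_pow]

omit [CharP E p] in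
/-- The product of two `p`-monomials is an `E^p`-multiple of a `p`-monomial (reduce exponents mod `p`). [folklore] -/
theorem pMonomial_mul_pMonomial {r : ℕ} (β : Fin r → E) (e e' : Fin r → Fin p) :
    ∃ c : E, pMonomial p β e * pMonomial p β e' =
      c ^ p * pMonomial p β (fun i => ⟨((e i : ℕ) + e' i) % p, Nat.mod_lt _ (Fact.out : p.Prime).pos⟩) := by
  refine ⟨∏ i, β i ^ (((e i : ℕ) + e' i) / p), ?_⟩
  simp only [pMonomial]
  rw [← Finset.prod_pow, ← Finset.prod_mul_distrib, ← Finset.prod_mul_distrib]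
  refine Finset.prod_congr rfl fun i _ => ?_
  rw [← pow_add, ← pow_mul, ← pow_add]
  congr 1
  rw [mul_comm]
  exact (Nat.div_add_mod _ _).symm

/-- Every element of `E^p[β]` (`= E^p(β)`, the `β i` being radical over `E^p`) is an `E^p`-linear combination of the `p`-monomials of `β`.
[cite: Matsumura1987, §26 p. 202] -/
theorem mem_span_pMonomial_of_mem_adjoin {r : ℕ} (β : Fin r → E) {x : E}
    (hx : x ∈ adjoin (frobenius E p).fieldRange (Set.range β)) :
    x ∈ Submodule.span (frobenius E p).fieldRange (Set.range (pMonomial p β)) := by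
  have hp : p.Prime := Fact.out
  set Ep : Subfield E := (frobenius E p).fieldRange
  set V : Submodule Ep E := Submodule.span Ep (Set.range (pMonomial p β))
  -- the generators are algebraic (radical) over `E^p`
  have halg : ∀ y ∈ Set.range β, IsAlgebraic Ep y := by
    rintro _ ⟨i, rfl⟩
    have hmem : β i ^ p ∈ (algebraMap Ep E).range := ⟨⟨β i ^ p, β i, rfl⟩, rfl⟩
    obtain ⟨a, ha⟩ := hmem
    refine ⟨Polynomial.X ^ p - Polynomial.C a, ?_, ?_⟩
    · exact Polynomial.X_pow_sub_C_ne_zero hp.pos a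
    · simp [ha]
  have hx' : x ∈ Algebra.adjoin Ep (Set.range β) := by
    rw [← adjoin_toSubalgebra_of_isAlgebraic halg]; exact hx
  clear hx
  -- the monomials contain `1` and the `β i`
  have hone : (1 : E) ∈ V := by
    have h1 : pMonomial p β (fun _ => ⟨0, hp.pos⟩) = 1 := by simp [pMonomial]
    exact h1 ▸ Submodule.subset_span ⟨_, rfl⟩
  have hβ : ∀ i, β i ∈ V := by
    intro i
    classical
    have h1 : pMonomial p β (fun j => if j = i then ⟨1, hp.one_lt⟩ else ⟨0, hp.pos⟩) = β i := by
      simp only [pMonomial]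
      rw [Finset.prod_eq_single i (fun j _ hj => by simp [hj]) (by simp)]
      simp
    exact h1 ▸ Submodule.subset_span ⟨_, rfl⟩
  -- `V` is closed under multiplication
  have key : ∀ e e', pMonomial p β e * pMonomial p β e' ∈ V := by
    intro e e'
    obtain ⟨c, hc⟩ := pMonomial_mul_pMonomial p β e e'
    rw [hc]
    have : (c ^ p : E) * pMonomial p β _ = (⟨c ^ p, c, rfl⟩ : Ep) • pMonomial p β
        (fun i => ⟨((e i : ℕ) + e' i) % p, Nat.mod_lt _ hp.pos⟩) := rfl
    rw [this]
    exact V.smul_mem _ (Submodule.subset_span ⟨_, rfl⟩)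
  have h1 : ∀ e, ∀ y ∈ V, pMonomial p β e * y ∈ V := by
    intro e y hy
    induction hy using Submodule.span_induction with
    | mem z hz => obtain ⟨e', rfl⟩ := hz; exact key e e'
    | zero => simp
    | add z w _ _ hz hw => rw [mul_add]; exact V.add_mem hz hw
    | smul a z _ hz => rw [mul_smul_comm]; exact V.smul_mem a hz
  have hmul : ∀ x' ∈ V, ∀ y ∈ V, x' * y ∈ V := by
    intro x' hx' y hy
    induction hx' using Submodule.span_induction with
    | mem z hz => obtain ⟨e, rfl⟩ := hz; exact h1 e y hy
    | zero => simp
    | add z w _ _ hz hw => rw [add_mul]; exact V.add_mem hz hw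
    | smul a z _ hz => rw [smul_mul_assoc]; exact V.smul_mem a hz
  induction hx' using Algebra.adjoin_induction with
  | mem z hz => obtain ⟨i, rfl⟩ := hz; exact hβ i
  | algebraMap a =>
    have : algebraMap Ep E a = a • (1 : E) := by rw [Algebra.smul_def, mul_one]
    rw [this]; exact V.smul_mem a hone
  | add z w _ _ hz hw => exact V.add_mem hz hw
  | mul z w _ _ hz hw => exact hmul z hz w hw

/-- The `p`-monomials of an injective `p`-independent family are linearly independent over `E^p`
(they span `E^p(β)`, of degree `p^r`, and there are `p^r` of them). [cite: Matsumura1987, §26 p. 202] -/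
theorem linearIndependent_pMonomial {r : ℕ} (β : Fin r → E) (hβ : Function.Injective β)
    (hPI : IsPIndependent (F := (frobenius E p).fieldRange) p (Set.range β)) :
    LinearIndependent (frobenius E p).fieldRange (pMonomial p β) := by
  classical
  have hp : p.Prime := Fact.out
  set Ep : Subfield E := (frobenius E p).fieldRange
  set L : IntermediateField Ep E := adjoin Ep (Set.range β)
  have hrange : ((Finset.univ.image β : Finset E) : Set E) = Set.range β := by
    rw [Finset.coe_image, Finset.coe_univ, Set.image_univ]
  have hL : finrank Ep L = p ^ r := by
    have h := hPI (Finset.univ.image β) hrange.le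
    rw [hrange, Finset.card_image_of_injective _ hβ, Finset.card_univ, Fintype.card_fin] at h
    exact h
  have hmemL : ∀ e, pMonomial p β e ∈ L := fun e =>
    prod_mem fun i _ => pow_mem (subset_adjoin Ep (Set.range β) (Set.mem_range_self i)) _
  let m : (Fin r → Fin p) → L := fun e => ⟨pMonomial p β e, hmemL e⟩
  have hspan : (⊤ : Submodule Ep L) ≤ Submodule.span Ep (Set.range m) := by
    rintro ⟨x, hxL⟩ -
    have hx := mem_span_pMonomial_of_mem_adjoin p β hxL
    have himage : Set.range (pMonomial p β) = (L.val.toLinearMap : L →ₗ[Ep] E) '' Set.range m := by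
      ext y; constructor
      · rintro ⟨e, rfl⟩; exact ⟨m e, ⟨e, rfl⟩, rfl⟩
      · rintro ⟨_, ⟨e, rfl⟩, rfl⟩; exact ⟨e, rfl⟩
    rw [himage, ← Submodule.map_span] at hx
    obtain ⟨y, hy, hyx⟩ := hx
    have : y = ⟨x, hxL⟩ := Subtype.ext hyx
    exact this ▸ hy
  have hcard : Fintype.card (Fin r → Fin p) = finrank Ep L := by
    rw [Fintype.card_fun, Fintype.card_fin, Fintype.card_fin, hL]
  have hli : LinearIndependent Ep m := linearIndependent_of_top_le_span_of_card_eq_finrank hspan hcard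
  have := hli.map' L.val.toLinearMap (LinearMap.ker_eq_bot.mpr Subtype.val_injective)
  exact this

end MonomialBasis

end Summit.ResolutionOfSingularities.ResolutionOfSingularities.Theorems.RadicialJungCleanModels.Lens5TFrame

end
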